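import Literature.NumberTheory.EllipticCurves.ModularCurveEtaProductsProofs
import Literature.NumberTheory.EllipticCurves.ComplexMultiplicationHasCMProofs
import Literature.NumberTheory.EllipticCurves.Szpiro
import HarnessLib

/-!
# Weight-`2` cusp forms of level dividing `32` (Darmon–Merel 1997, Cor. 3.2 and §4, modular side)

Topic `Literature/NumberTheory/DiophantineGeometry`; namespace
`Literature.NumberTheory.DiophantineGeometry`. Third companion proof file (theorems only, no
definitions, no named facts) of the named fact
`Literature.NumberTheory.DiophantineGeometry.darmonMerel1997_denesEquation`
(`GeneralizedFermatTwoPowerCoefficient`), after `DenesEquationFreyCurveProofs` (§1) and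
`DenesEquationModPRepresentationProofs` (Thm. 2.2). It records, from theorems already in the tree
(`ModularCurveSturmProofs`: the cuspidal Sturm bound and the genus-zero levels;
`ModularCurveEtaProductsProofs`: `S₂(Γ₀(32)) = ℂ η(4τ)²η(8τ)²`), the two facts about spaces of
weight-`2` cusp forms that H. Darmon, L. Merel, *Winding quotients and some variants of Fermat's
Last Theorem*, J. reine angew. Math. 490 (1997) 81–100, use after Ribet's level-lowering (Thm. 3.1)
for the Frey curve of `aᵖ + bᵖ = 2cᵖ`, whose mod `p` representation `ρ` has Serre conductor
`N(ρ) = 2` (`abc` even) or `N(ρ) ∣ 32` (`abc` odd) by their Lemma 2.1: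

* proof of Cor. 3.2 (p. 9 of the 26-page version): "this representation corresponds to a mod `p`
  eigenform of weight `2` and level `2` or `3`. This is impossible since there are no weight `2`
  cusp forms of these levels" — here `S₂(Γ₀(M)) = 0` for every `M ∣ 16`
  (`cuspForm_two_gamma0_eq_zero_of_dvd_sixteen`), so that a non-zero weight-`2` cusp form of level
  dividing `32` has level exactly `32` (`eq_thirtyTwo_of_dvd_of_ne_zero`);
* §4, first paragraph (pp. 9–10): "we now know that `ρ` corresponds to a mod `p` eigenform of
  weight `2` and level `32` … The curves `X₀(32)` and `X₀(27)` are both curves of genus `1` … It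
  follows that `ρ` is isomorphic to the Galois representation given by the action on the
  `p`-division points of the elliptic curve `X₀(32)`" — here, on the modular-form side:
  `S₂(Γ₀(32))` is the line spanned by `η(4τ)²η(8τ)²` (`exists_smul_etaProductThirtyTwo_of_dvd`).

* §4, p. 10: "`X₀(32) : Y² = X³ − X` … (Note that these curves are also the Frey curves that are
  associated to the trivial solution `(1, 1, 1)` of equation (1) …) … Both of these curves have
  complex multiplication: `X₀(32)` by the ring of Gaussian integers `ℤ[i]`" — here: the Frey curve
  `freyCurve 1 (-2) : y² = x(x − 1)(x − 2)` of the trivial solution is carried by `x ↦ x + 1` to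
  `Y² = X³ − X` (`variableChange_freyCurve_trivial`), has `j = 1728` (`j_freyCurve_trivial`) and
  complex multiplication (`hasCM_freyCurve_trivial`, from the tree's `hasCM_of_j_eq_1728`)
  (appended 2026-08-16).

These are characteristic-`0` statements (the tree's form of Serre's conjecture,
`Literature.NumberTheory.Automorphic.khare_wintenberger`, produces genuine newforms); they do not
touch the Galois side of §4 (the isomorphism `ρ ≅ X₀(32)[p]`, Props. 4.1–4.3), nor Lemma 2.1,
Thm. 3.1, Thm. 8.1 or Cor. 9.1, none of which is in reach of the tree.

## References

* H. Darmon, L. Merel, J. reine angew. Math. 490 (1997) 81–100, Cor. 3.2 (proof) and §4.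
  [DarmonMerel1997]
* F. Diamond, J. Shurman, *A first course in modular forms*, GTM 228 (2005), Thm. 3.5.1,
  Prop. 3.2.2, Figure 3.3. [DiamondShurman2005]
-/

noncomputable section

open scoped MatrixGroups ModularForm
open CongruenceSubgroup
open Literature.NumberTheory.EllipticCurves.ModularForms

namespace Literature.NumberTheory.DiophantineGeometry

/-- **No weight-`2` cusp forms of level dividing `16`**: `S₂(Γ₀(M)) = 0` for `M ∣ 16`, i.e.
`M ∈ {1, 2, 4, 8, 16}` — the curves `X₀(M)` have genus `0` (Diamond–Shurman Thm. 3.5.1,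
Figure 3.3); in the tree by the cuspidal Sturm bound (`cuspForm_two_gamma0_eq_zero_of_le_ten` for
`M ≤ 8`, `finrank_cuspForm_two_eq_genusX0_of_mem` and `g(X₀(16)) = 0` for `M = 16`). This is the
input "there are no weight `2` cusp forms of these levels" of Darmon–Merel's proof of Cor. 3.2
(level `2`), extended to the levels `4, 8, 16` needed to pin the level `32` in §4.
[cite: DarmonMerel1997, Cor. 3.2 (proof)] -/
theorem cuspForm_two_gamma0_eq_zero_of_dvd_sixteen {M : ℕ} [NeZero M] (hM : M ∣ 16)
    (f : CuspForm (Gamma0 M) 2) : f = 0 := by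
  have hM16 : M ≤ 16 := Nat.le_of_dvd (by norm_num) hM
  by_cases h10 : M ≤ 10
  · exact cuspForm_two_gamma0_eq_zero_of_le_ten h10 f
  · obtain rfl : M = 16 := by
      have hM0 : M ≠ 0 := NeZero.ne M
      interval_cases M <;> omega
    have hfd : FiniteDimensional ℂ (CuspForm (Gamma0 16) 2) :=
      finiteDimensional_cuspForm_gamma0 16 2
    have h := finrank_cuspForm_two_eq_genusX0_of_mem (N := 16) (by decide)
    obtain ⟨hμ, hν, h₂, h₃⟩ := gamma0_data_16
    have hg : genusX0 16 = 0 := by rw [genusX0, hμ, hν, h₂, h₃]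
    rw [finrank_cuspForm_two_eq_genusX0, hg] at h
    exact finrank_zero_iff_forall_zero.mp h f

/-- **A non-zero weight-`2` cusp form of level dividing `32` has level exactly `32`** (the levels
`1, 2, 4, 8, 16` carry none, `cuspForm_two_gamma0_eq_zero_of_dvd_sixteen`): the modular-form side
of Darmon–Merel §4, first sentence ("we now know that `ρ` corresponds to a mod `p` eigenform of
weight `2` and level `32`", given `N(ρ) ∣ 32` from Lemma 2.1 and Cor. 3.2).
[cite: DarmonMerel1997, §4 (first paragraph)] -/
theorem eq_thirtyTwo_of_dvd_of_ne_zero {M : ℕ} [NeZero M] (hM : M ∣ 32)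
    (f : CuspForm (Gamma0 M) 2) (hf : f ≠ 0) : M = 32 := by
  by_contra h32
  have h16 : M ∣ 16 := by
    have hM32 : M ≤ 32 := Nat.le_of_dvd (by norm_num) hM
    have hM0 : M ≠ 0 := NeZero.ne M
    interval_cases M <;> omega
  exact hf (cuspForm_two_gamma0_eq_zero_of_dvd_sixteen h16 f)

/-- **`S₂(Γ₀(32))` is the line spanned by `η(4τ)²η(8τ)²`** (the newform of the elliptic curve
`X₀(32) : Y² = X³ − X` of Darmon–Merel §4; `g(X₀(32)) = 1`, Diamond–Shurman Figure 3.3): every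
weight-`2` cusp form of level `M ∣ 32` is, if `M = 32`, a multiple of the tree's
`cuspFormEtaProductThirtyTwo`, and is `0` otherwise. In the tree:
`finrank_cuspForm_two_eq_genusX0_thirtyTwo` (`ModularCurveEtaProductsProofs`).
[cite: DarmonMerel1997, §4 (first paragraph)] -/
theorem exists_smul_etaProductThirtyTwo_of_dvd {M : ℕ} [NeZero M] (hM : M ∣ 32)
    (f : CuspForm (Gamma0 M) 2) :
    f = 0 ∨
      (M = 32 ∧ ∀ g : CuspForm (Gamma0 32) 2, ∃ c : ℂ, c • cuspFormEtaProductThirtyTwo = g) := by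
  by_cases hf : f = 0
  · exact Or.inl hf
  · exact Or.inr ⟨eq_thirtyTwo_of_dvd_of_ne_zero hM f hf,
      finrank_cuspForm_two_eq_genusX0_thirtyTwo.2.2⟩

/-- `dim_ℂ S₂(Γ₀(32)) = 1`, restated from `ModularCurveEtaProductsProofs` for the record of
Darmon–Merel §4 ("`X₀(32)` … of genus `1`"). [cite: DarmonMerel1997, §4 (first paragraph)] -/
theorem finrank_cuspForm_two_gamma0_thirtyTwo :
    Module.finrank ℂ (CuspForm (Gamma0 32) 2) = 1 :=
  finrank_cuspForm_two_eq_genusX0_thirtyTwo.2.1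

/-! ### The Frey curve of the trivial solution is `X₀(32) : Y² = X³ − X` (Darmon–Merel §4, p. 10)

Appended 2026-08-16. -/

section TrivialSolution

open WeierstrassCurve Literature.NumberTheory.EllipticCurves

/-- **The Frey curve of the trivial solution `(1, 1, 1)` of `xᵖ + yᵖ = 2zᵖ` is
`X₀(32) : Y² = X³ − X`** (Darmon–Merel §4, p. 10: "Note that these curves are also the Frey curves
that are associated to the trivial solution `(1, 1, 1)` of equation (1)"): the curve (4) of
`(a, b, c) = (1, 1, 1)` is `Y² = X(X − 1)(X − 2)`, i.e. `freyCurve 1 (-2)` (`A = aᵖ = 1`,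
`B = −2cᵖ = −2`), and the substitution `X ↦ X + 1` (the variable change `(u, r, s, t) =
(1, 1, 0, 0)`) turns it into `Y² = X³ − X`. [cite: DarmonMerel1997, §4 (p. 10)] -/
theorem variableChange_freyCurve_trivial :
    (⟨1, 1, 0, 0⟩ : VariableChange ℚ) • freyCurve 1 (-2) = ⟨0, 0, 0, -1, 0⟩ := by
  ext <;> simp [freyCurve, variableChange_def] <;> norm_num

/-- The Frey curve `y² = x(x − 1)(x − 2)` of the trivial solution is an elliptic curve
(`A B (A + B) = 1 · (−2) · (−1) ≠ 0`). [folklore] -/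
theorem isElliptic_freyCurve_trivial : (freyCurve 1 (-2)).IsElliptic :=
  isElliptic_freyCurve (by norm_num)

/-- **`j(X₀(32)) = 1728`**: the Frey curve of the trivial solution, `y² = x(x − 1)(x − 2) ≅
Y² = X³ − X`, has `c₄ = 48`, `Δ = 64`, `j = 48³/64 = 1728` (Darmon–Merel §4, p. 10: `X₀(32)` has
complex multiplication by `ℤ[i]`, i.e. `j = 1728`). [cite: DarmonMerel1997, §4 (p. 10)] -/
theorem j_freyCurve_trivial :
    haveI := isElliptic_freyCurve_trivial
    (freyCurve 1 (-2)).j = 1728 := by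
  haveI := isElliptic_freyCurve_trivial
  have hΔ : (freyCurve 1 (-2)).Δ = 64 := by rw [freyCurve_Δ]; norm_num
  have hc : (freyCurve 1 (-2)).c₄ = 48 := by
    simp only [WeierstrassCurve.c₄, WeierstrassCurve.b₂, WeierstrassCurve.b₄, freyCurve_a₁,
      freyCurve_a₂, freyCurve_a₃, freyCurve_a₄]
    norm_num
  rw [j, Units.inv_mul_eq_iff_eq_mul, hc, coe_Δ', hΔ]
  norm_num

/-- **`X₀(32)` has complex multiplication** (Darmon–Merel §4, p. 10: "Both of these curves have
complex multiplication: `X₀(32)` by the ring of Gaussian integers `ℤ[i]`"): the Frey curve of the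
trivial solution has geometric CM (`WeierstrassCurve.HasCM`: `End_{ℚ̄}(E) ≠ ℤ`), by `j = 1728` and
the tree's `hasCM_of_j_eq_1728` (the automorphism `(x, y) ↦ (−x, iy)`, Silverman *AEC* III
Example 4.4). That the CM ring is exactly `ℤ[i]` is not asserted here.
[cite: DarmonMerel1997, §4 (p. 10)] -/
theorem hasCM_freyCurve_trivial : (freyCurve 1 (-2)).HasCM :=
  haveI := isElliptic_freyCurve_trivial
  hasCM_of_j_eq_1728 _ j_freyCurve_trivial

end TrivialSolution

end Literature.NumberTheory.DiophantineGeometry
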